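import Summits.HodgeConjecture.HodgeConjecture.Theorems.WeilTypeLadderFermatTransfer
import Literature.AlgebraicGeometry.HodgeTheory.WeilClassesCyclicPrymTyping
import HarnessLib

/-!
# WeilTypeLadder · the Fermat transfer on the NAMED family: ζ₆-primitive Pryms of `ℤ/6`-covers of `ℙ¹`
# with 8 branch points (THEOREM F of the packet in transferred form), and the R3-shaped transfer

b2b cell `hweil` (packet `run/shared/lean/b2b/hodge-weil/`, reports `b2b-hweil-pv3-g37/FERMAT-TRANSFER.md`,
`b2b-hweil-pv3-g38/KERNEL-TRANSFER.md`). Companion of `Theorems/WeilTypeLadderFermatTransfer` (the Fermat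
transfer principle `mem_algebraicClasses_of_fermatTransfer`: Shioda 1979 + Fulton Cor. 19.2 (b) + the degree
trick). This file writes the principle ON THE FAMILY of the packet's THEOREM F at `m = 6`, `N = 8`, in the
binder style of the tree's Schoen facts (`Schoen1988_cyclicPrym_weilClasses_algebraic_degreeSix` and its
transferred form `…_of_forall_exists_surjective`, `HodgeTheory/WeilClassesCyclicPrymTransfer`):

* THE FAMILY (kernel rendering). `C` a smooth projective complex curve with a Jacobian `𝒥` and an
  automorphism `α` with `α⁶ = 𝟙`; `s := α_*` on `J(C)`; **`C/⟨α⟩ ≅ ℙ¹`** rendered as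
  `𝟙 + s + s² + s³ + s⁴ + s⁵ = 0` on `J(C)` (the norm endomorphism of the cover `C → C/⟨α⟩` factors through
  `J(C/⟨α⟩)`, which is `0` iff `g(C/⟨α⟩) = 0`); `B := (ker(𝟙 - s + s²))⁰ = (ker Φ₆(s))⁰ ⊂ J(C)` the
  ζ₆-PRIMITIVE PRYM (the tree's `AbelianVariety.kerComponent`, Schoen's `B`), `s_B` the restriction of `s`,
  Weil operator `ψ₀ := 𝟙 + 2 s_B²` (`ψ₀² = -3`, `K = ℚ(√-3)`; tree lemma `kerComponent_weilOperator_comp_self'`);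
  **`dim B = 6`**, i.e. (Schoen Lemma 1.5, `h = -e(ℙ¹ ∖ branch locus) = N - 2`) EXACTLY `N = 8` BRANCH POINTS.
  Weil type `(3,3)` (Schoen Cor. 1.9: `Σⱼ⟨nβⱼ⟩₆ = 24` for `n = 1, 5`) is not a separate binder: it enters
  through the hypothesis "`c` rational of Hodge type `(3,3)`" of the R∞ / R1′ bodies (off Weil type the Weil
  plane has no non-zero `(3,3)` class). The rotation tuple `β` itself (31 Weil tuples, 18 non-simple, 12 of
  them NON-SPLIT = CENSUS C15: `Theorems/WeilTypeLadderCyclicSexticTuples`) is not on the tree's carriers.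
* THE TRANSFER DATUM `(X = X⁶₆, T, a, b)` and the Fermat partners `a^* c = b^* c'` are HYPOTHESES here; the
  packet's THEOREM F / PROPOSITION T (pen-and-paper; KEY LEMMA `C⁶/G ≅ X⁶₆/ker β` for EVERY branch
  configuration, `T` a resolution of a dominant component of `C⁶ ×_{C⁶/G} X⁶₆`, `a = (Σᵢ Abel–Prym ∘ prᵢ) ∘ pr_{C⁶}`
  surjective, `b = pr_X`, `a^*(U' ⊗ ℂ) = b^*(M ⊗ ℂ)`) supplies them for EVERY member of EVERY one of the 31
  families. That geometry is not formalisable on the present carriers and is not restated as a named fact.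
* `cyclicSexticPrym_weilClassesOf_le_algebraicClasses_of_facts` — on the family, granted the datum with a
  partner for every Weil class, the whole Weil plane `weilClassesOf B ψ₀ 3 3` is algebraic (Shioda + Fulton);
  `weilClassesImaginaryQuadratic_cyclicSexticPrym_fermat_of_facts` / `_of_weilClassesImaginaryQuadratic` /
  `_of_hodgeConjecture` — the R∞-shaped body (`n = 3`, `d = 3`) on the family with datum (facts / rung / ON-PATH);
  `nonsplitSixfolds_cyclicSexticPrym_fermat_of_facts` / `_of_nonsplitSixfolds` / `_of_hodgeConjecture` — the
  R1′-shaped body (`NonsplitSixfolds`, `d = 3`, non-hyperbolicity binder carried unused) on the family with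
  datum — the CL4-candidate "C15 families (ℚ(√-3), 3, −2)" in kernel form;
  `weilClassesCMField_fermatTransfer_of_facts` / `_of_weilClassesCMField` / `_of_hodgeConjecture` — the R3-shaped
  body (`WeilClassesCMField`, any CM field, carrier `weilClassesField`) with a Fermat transfer datum `(Xᵏₘ, T, a, b)`,
  `m` prime or `≤ 20` (THEOREM F for composite `m ∈ {8, …, 20}`, `E = ℚ(ζ_m)`: report §3.5).

HONEST LABEL: sub-families (5 of 9 moduli for `N = 8`), not the general member of any component; 0
unconditional rungs above the floor added; conditional on [Shioda 1979] + [Fulton 1998 Cor. 19.2 (b)]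
(refereed) only AND on the transfer datum (pen-and-paper, packet); Markman-free. No `sorry`, no new
definition, no new named fact.
-/

noncomputable section

-- every declaration of this problem lives in `Summit.HodgeConjecture.HodgeConjecture.…` (summit = sub-problem)
set_option linter.dupNamespace false

open CategoryTheory
open Literature.AlgebraicGeometry Literature.AlgebraicGeometry.Motives
open Literature.AlgebraicGeometry.HodgeTheory
open Literature.AlgebraicTopology.SingularHomology

namespace Summit.HodgeConjecture.HodgeConjecture.WeilTypeLadder

/-! ### §1 The family: the whole Weil plane from a datum with partners -/

section Family

/-- **THEOREM F (`m = 6`, `N = 8`) in transferred form.** For every datum `(C, 𝒥, α, s = α_*)` with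
`α⁶ = 𝟙`, `C/⟨α⟩ ≅ ℙ¹` (`Σ_{i<6} sⁱ = 0`), primitive Prym `B = (ker(𝟙 - s + s²))⁰` of dimension `6` (8 branch
points), `ψ₀ = 𝟙 + 2 s_B²`, and every Fermat transfer datum (`X` the smooth projective Fermat sextic sixfold,
`T` smooth projective of dimension `6`, `a : T ⟶ B` surjective, `b : T ⟶ X`) with a Fermat partner for every
class of the Weil plane, `weilClassesOf B ψ₀ 3 3 ≤ algebraicClasses B 3`. Conditional on [Shioda 1979] and
[Fulton 1998, Cor. 19.2 (b)]. [cite: Shioda1979PJA, §2 Thm. 1 and the list after it (p. 112)]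
[cite: Fulton1998, §19.2 Cor. 19.2 (b)] [cite: Schoen1988HodgeWeil, §1 Lemma 1.1, Lemma 1.5, Cor. 1.9, §3 Cor. 3.1 (proof, pp. 24–25)] -/
theorem cyclicSexticPrym_weilClassesOf_le_algebraicClasses_of_facts
    (hF : hodgeClasses_algebraic_fermat) (hP : fulton1998_map_mem_algebraicClasses) :
    ∀ (C : Motives.SchemeOver ℂ) (𝒥 : Jacobian C) (α : C ⟶ C),
      IsSmoothProjective 1 C → α ≫ α ≫ α ≫ α ≫ α ≫ α = 𝟙 C →
    ∀ (s : 𝒥.J ⟶ 𝒥.J), s = 𝒥.pushforward 𝒥 α →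
      𝟙 𝒥.J + s + s ≫ s + s ≫ s ≫ s + s ≫ s ≫ s ≫ s + s ≫ s ≫ s ≫ s ≫ s = 0 →
    ∀ (sB ψ₀ : AbelianVariety.kerComponent (𝟙 𝒥.J - s + s ≫ s) ⟶
        AbelianVariety.kerComponent (𝟙 𝒥.J - s + s ≫ s)),
      sB ≫ AbelianVariety.kerComponentι (𝟙 𝒥.J - s + s ≫ s) =
        AbelianVariety.kerComponentι (𝟙 𝒥.J - s + s ≫ s) ≫ s →
      ψ₀ = 𝟙 _ + 2 • (sB ≫ sB) →
      (AbelianVariety.kerComponent (𝟙 𝒥.J - s + s ≫ s)).dim = 2 * 3 →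
    ∀ (X T : Motives.SchemeOver ℂ),
      IsFermatVariety 6 6 X → IsSmoothProjective 6 X → IsSmoothProjective (2 * 3) T →
    ∀ (a : T ⟶ (AbelianVariety.kerComponent (𝟙 𝒥.J - s + s ≫ s)).X) (b : T ⟶ X),
      AlgebraicGeometry.Surjective a.left →
      (∀ c ∈ weilClassesOf (AbelianVariety.kerComponent (𝟙 𝒥.J - s + s ≫ s)) ψ₀ 3 3,
        ∃ c' ∈ Submodule.span ℂ
            {x : complexBetti X (2 * 3) | IsRationalClass x ∧ IsOfHodgeType 6 X (2 * 3) 3 3 x},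
          complexBetti.map a (2 * 3) c = complexBetti.map b (2 * 3) c') →
      weilClassesOf (AbelianVariety.kerComponent (𝟙 𝒥.J - s + s ≫ s)) ψ₀ 3 3 ≤
        algebraicClasses (AbelianVariety.kerComponent (𝟙 𝒥.J - s + s ≫ s)).X 3 := by
  intro C 𝒥 α _ _ s _ _ sB ψ₀ _ _ hdim X T hXF hX hT a b ha h
  exact weilClassesOf_sixfold_le_algebraicClasses_of_fermatSexticTransfer hF hP hdim hXF hX hT a b h

end Family

/-! ### §2 R∞-shaped body (`n = 3`, `d = 3`) on the family with datum -/

section FamilyRinfty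

/-- **R∞ (`WeilClassesImaginaryQuadratic` at `n = 3`, `d = 3`) on the family with a Fermat transfer
datum, from the two facts**: family binders, then `dim B = 6`, smooth projective, `ψ₀ ≫ ψ₀ = -3` (the
rung's binders at `(A, φ) := (B, ψ₀)`), then the datum, then for every class `c` with a Fermat partner:
rational of type `(3,3)` in the Weil plane ⇒ algebraic (rationality / type / `ψ₀² = -3` carried, not used).
[cite: Shioda1979PJA, §2 Thm. 1 and the list after it (p. 112)] [cite: Fulton1998, §19.2 Cor. 19.2 (b)] -/
theorem weilClassesImaginaryQuadratic_cyclicSexticPrym_fermat_of_facts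
    (hF : hodgeClasses_algebraic_fermat) (hP : fulton1998_map_mem_algebraicClasses) :
    ∀ (C : Motives.SchemeOver ℂ) (𝒥 : Jacobian C) (α : C ⟶ C),
      IsSmoothProjective 1 C → α ≫ α ≫ α ≫ α ≫ α ≫ α = 𝟙 C →
    ∀ (s : 𝒥.J ⟶ 𝒥.J), s = 𝒥.pushforward 𝒥 α →
      𝟙 𝒥.J + s + s ≫ s + s ≫ s ≫ s + s ≫ s ≫ s ≫ s + s ≫ s ≫ s ≫ s ≫ s = 0 →
    ∀ (sB ψ₀ : AbelianVariety.kerComponent (𝟙 𝒥.J - s + s ≫ s) ⟶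
        AbelianVariety.kerComponent (𝟙 𝒥.J - s + s ≫ s)),
      sB ≫ AbelianVariety.kerComponentι (𝟙 𝒥.J - s + s ≫ s) =
        AbelianVariety.kerComponentι (𝟙 𝒥.J - s + s ≫ s) ≫ s →
      ψ₀ = 𝟙 _ + 2 • (sB ≫ sB) →
      (AbelianVariety.kerComponent (𝟙 𝒥.J - s + s ≫ s)).dim = 2 * 3 →
      IsSmoothProjective (2 * 3) (AbelianVariety.kerComponent (𝟙 𝒥.J - s + s ≫ s)).X →
      ψ₀ ≫ ψ₀ = -((3 : ℕ) • 𝟙 _) →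
    ∀ (X T : Motives.SchemeOver ℂ),
      IsFermatVariety 6 6 X → IsSmoothProjective 6 X → IsSmoothProjective (2 * 3) T →
    ∀ (a : T ⟶ (AbelianVariety.kerComponent (𝟙 𝒥.J - s + s ≫ s)).X) (b : T ⟶ X),
      AlgebraicGeometry.Surjective a.left →
      ∀ c : complexBetti (AbelianVariety.kerComponent (𝟙 𝒥.J - s + s ≫ s)).X (2 * 3),
        (∃ c' ∈ Submodule.span ℂ
            {x : complexBetti X (2 * 3) | IsRationalClass x ∧ IsOfHodgeType 6 X (2 * 3) 3 3 x},
          complexBetti.map a (2 * 3) c = complexBetti.map b (2 * 3) c') →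
        IsRationalClass c →
        IsOfHodgeType (2 * 3) (AbelianVariety.kerComponent (𝟙 𝒥.J - s + s ≫ s)).X (2 * 3) 3 3 c →
        c ∈ weilClassesOf (AbelianVariety.kerComponent (𝟙 𝒥.J - s + s ≫ s)) ψ₀ 3 3 →
        c ∈ algebraicClasses (AbelianVariety.kerComponent (𝟙 𝒥.J - s + s ≫ s)).X 3 := by
  intro C 𝒥 α _ _ s _ _ sB ψ₀ _ _ _ hB _ X T hXF hX hT a b ha c hc _ _ _
  obtain ⟨c', hc', hab⟩ := hc
  exact mem_algebraicClasses_of_fermatTransfer hF hP (m := 6) (Or.inr ⟨by norm_num, by norm_num⟩) hXF hX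
    hB hT a b hc' hab

/-- **The same body from the rung R∞ itself** (`WeilClassesImaginaryQuadratic` at `n = 3`, `d = 3`,
`(A, φ) := (B, ψ₀)`; family and datum not used): the family is a CASE of the rung. -/
theorem weilClassesImaginaryQuadratic_cyclicSexticPrym_fermat_of_weilClassesImaginaryQuadratic
    (h : WeilClassesImaginaryQuadratic) :
    ∀ (C : Motives.SchemeOver ℂ) (𝒥 : Jacobian C) (α : C ⟶ C),
      IsSmoothProjective 1 C → α ≫ α ≫ α ≫ α ≫ α ≫ α = 𝟙 C →
    ∀ (s : 𝒥.J ⟶ 𝒥.J), s = 𝒥.pushforward 𝒥 α →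
      𝟙 𝒥.J + s + s ≫ s + s ≫ s ≫ s + s ≫ s ≫ s ≫ s + s ≫ s ≫ s ≫ s ≫ s = 0 →
    ∀ (sB ψ₀ : AbelianVariety.kerComponent (𝟙 𝒥.J - s + s ≫ s) ⟶
        AbelianVariety.kerComponent (𝟙 𝒥.J - s + s ≫ s)),
      sB ≫ AbelianVariety.kerComponentι (𝟙 𝒥.J - s + s ≫ s) =
        AbelianVariety.kerComponentι (𝟙 𝒥.J - s + s ≫ s) ≫ s →
      ψ₀ = 𝟙 _ + 2 • (sB ≫ sB) →
      (AbelianVariety.kerComponent (𝟙 𝒥.J - s + s ≫ s)).dim = 2 * 3 →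
      IsSmoothProjective (2 * 3) (AbelianVariety.kerComponent (𝟙 𝒥.J - s + s ≫ s)).X →
      ψ₀ ≫ ψ₀ = -((3 : ℕ) • 𝟙 _) →
    ∀ (X T : Motives.SchemeOver ℂ),
      IsFermatVariety 6 6 X → IsSmoothProjective 6 X → IsSmoothProjective (2 * 3) T →
    ∀ (a : T ⟶ (AbelianVariety.kerComponent (𝟙 𝒥.J - s + s ≫ s)).X) (b : T ⟶ X),
      AlgebraicGeometry.Surjective a.left →
      ∀ c : complexBetti (AbelianVariety.kerComponent (𝟙 𝒥.J - s + s ≫ s)).X (2 * 3),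
        (∃ c' ∈ Submodule.span ℂ
            {x : complexBetti X (2 * 3) | IsRationalClass x ∧ IsOfHodgeType 6 X (2 * 3) 3 3 x},
          complexBetti.map a (2 * 3) c = complexBetti.map b (2 * 3) c') →
        IsRationalClass c →
        IsOfHodgeType (2 * 3) (AbelianVariety.kerComponent (𝟙 𝒥.J - s + s ≫ s)).X (2 * 3) 3 3 c →
        c ∈ weilClassesOf (AbelianVariety.kerComponent (𝟙 𝒥.J - s + s ≫ s)) ψ₀ 3 3 →
        c ∈ algebraicClasses (AbelianVariety.kerComponent (𝟙 𝒥.J - s + s ≫ s)).X 3 := by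
  intro C 𝒥 α _ _ s _ _ sB ψ₀ _ _ hdim hB hψ _ _ _ _ _ _ _ _ c _ hc h33 hW
  exact h 3 (by norm_num) 3 (by norm_num) _ ψ₀ hdim hB hψ c hc h33 hW

/-- **On-path lemma**: the Hodge conjecture implies R∞ on the ζ₆-primitive Prym family with datum
(`HodgeConjecture → WeilClassesImaginaryQuadratic →` the family). -/
theorem weilClassesImaginaryQuadratic_cyclicSexticPrym_fermat_of_hodgeConjecture
    (h : _root_.HodgeConjecture) :
    ∀ (C : Motives.SchemeOver ℂ) (𝒥 : Jacobian C) (α : C ⟶ C),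
      IsSmoothProjective 1 C → α ≫ α ≫ α ≫ α ≫ α ≫ α = 𝟙 C →
    ∀ (s : 𝒥.J ⟶ 𝒥.J), s = 𝒥.pushforward 𝒥 α →
      𝟙 𝒥.J + s + s ≫ s + s ≫ s ≫ s + s ≫ s ≫ s ≫ s + s ≫ s ≫ s ≫ s ≫ s = 0 →
    ∀ (sB ψ₀ : AbelianVariety.kerComponent (𝟙 𝒥.J - s + s ≫ s) ⟶
        AbelianVariety.kerComponent (𝟙 𝒥.J - s + s ≫ s)),
      sB ≫ AbelianVariety.kerComponentι (𝟙 𝒥.J - s + s ≫ s) =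
        AbelianVariety.kerComponentι (𝟙 𝒥.J - s + s ≫ s) ≫ s →
      ψ₀ = 𝟙 _ + 2 • (sB ≫ sB) →
      (AbelianVariety.kerComponent (𝟙 𝒥.J - s + s ≫ s)).dim = 2 * 3 →
      IsSmoothProjective (2 * 3) (AbelianVariety.kerComponent (𝟙 𝒥.J - s + s ≫ s)).X →
      ψ₀ ≫ ψ₀ = -((3 : ℕ) • 𝟙 _) →
    ∀ (X T : Motives.SchemeOver ℂ),
      IsFermatVariety 6 6 X → IsSmoothProjective 6 X → IsSmoothProjective (2 * 3) T →
    ∀ (a : T ⟶ (AbelianVariety.kerComponent (𝟙 𝒥.J - s + s ≫ s)).X) (b : T ⟶ X),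
      AlgebraicGeometry.Surjective a.left →
      ∀ c : complexBetti (AbelianVariety.kerComponent (𝟙 𝒥.J - s + s ≫ s)).X (2 * 3),
        (∃ c' ∈ Submodule.span ℂ
            {x : complexBetti X (2 * 3) | IsRationalClass x ∧ IsOfHodgeType 6 X (2 * 3) 3 3 x},
          complexBetti.map a (2 * 3) c = complexBetti.map b (2 * 3) c') →
        IsRationalClass c →
        IsOfHodgeType (2 * 3) (AbelianVariety.kerComponent (𝟙 𝒥.J - s + s ≫ s)).X (2 * 3) 3 3 c →
        c ∈ weilClassesOf (AbelianVariety.kerComponent (𝟙 𝒥.J - s + s ≫ s)) ψ₀ 3 3 →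
        c ∈ algebraicClasses (AbelianVariety.kerComponent (𝟙 𝒥.J - s + s ≫ s)).X 3 :=
  weilClassesImaginaryQuadratic_cyclicSexticPrym_fermat_of_weilClassesImaginaryQuadratic
    (weilClassesImaginaryQuadratic_of_hodgeConjecture h)

end FamilyRinfty

/-! ### §3 R1′-shaped body (`NonsplitSixfolds`, `d = 3`) on the family with datum: CL4-candidate "CENSUS C15" -/

section FamilyRonePrime

/-- **R1′ (`NonsplitSixfolds` at `d = 3`) on the NON-SPLIT members of the family with a Fermat transfer
datum, from the two facts**: family binders, the rung's binders at `(A, φ) := (B, ψ₀)` INCLUDING "no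
hyperbolic `K`-symmetrised hyperplane class" (non-split Weil type — by the packet's THEOREM DISC-6 exactly the
tuples with an odd number of rotation numbers `3`: the twelve C15 families; carried, not used), the datum,
and the conclusion for every Weil class with a Fermat partner.
[cite: Shioda1979PJA, §2 Thm. 1 and the list after it (p. 112)] [cite: Fulton1998, §19.2 Cor. 19.2 (b)] -/
theorem nonsplitSixfolds_cyclicSexticPrym_fermat_of_facts
    (hF : hodgeClasses_algebraic_fermat) (hP : fulton1998_map_mem_algebraicClasses) :
    ∀ (C : Motives.SchemeOver ℂ) (𝒥 : Jacobian C) (α : C ⟶ C),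
      IsSmoothProjective 1 C → α ≫ α ≫ α ≫ α ≫ α ≫ α = 𝟙 C →
    ∀ (s : 𝒥.J ⟶ 𝒥.J), s = 𝒥.pushforward 𝒥 α →
      𝟙 𝒥.J + s + s ≫ s + s ≫ s ≫ s + s ≫ s ≫ s ≫ s + s ≫ s ≫ s ≫ s ≫ s = 0 →
    ∀ (sB ψ₀ : AbelianVariety.kerComponent (𝟙 𝒥.J - s + s ≫ s) ⟶
        AbelianVariety.kerComponent (𝟙 𝒥.J - s + s ≫ s)),
      sB ≫ AbelianVariety.kerComponentι (𝟙 𝒥.J - s + s ≫ s) =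
        AbelianVariety.kerComponentι (𝟙 𝒥.J - s + s ≫ s) ≫ s →
      ψ₀ = 𝟙 _ + 2 • (sB ≫ sB) →
      (AbelianVariety.kerComponent (𝟙 𝒥.J - s + s ≫ s)).dim = 2 * 3 →
      IsSmoothProjective (2 * 3) (AbelianVariety.kerComponent (𝟙 𝒥.J - s + s ≫ s)).X →
      ψ₀ ≫ ψ₀ = -((3 : ℕ) • 𝟙 _) →
      (∀ (e : Motives.ProjectiveEmbedding (AbelianVariety.kerComponent (𝟙 𝒥.J - s + s ≫ s)).X)
        (a : complexBetti (Motives.projectiveSpace e.n ℂ) 2), IsRationalClass a → a ≠ 0 →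
          ¬ Motives.IsHyperbolicWeilType (AbelianVariety.kerComponent (𝟙 𝒥.J - s + s ≫ s)) ψ₀ 3
            (((3 : ℕ) : ℂ) • complexBetti.map e.ι 2 a +
              complexBetti.map ψ₀.hom.hom.hom 2 (complexBetti.map e.ι 2 a))) →
    ∀ (X T : Motives.SchemeOver ℂ),
      IsFermatVariety 6 6 X → IsSmoothProjective 6 X → IsSmoothProjective (2 * 3) T →
    ∀ (a : T ⟶ (AbelianVariety.kerComponent (𝟙 𝒥.J - s + s ≫ s)).X) (b : T ⟶ X),
      AlgebraicGeometry.Surjective a.left →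
      ∀ c : complexBetti (AbelianVariety.kerComponent (𝟙 𝒥.J - s + s ≫ s)).X (2 * 3),
        (∃ c' ∈ Submodule.span ℂ
            {x : complexBetti X (2 * 3) | IsRationalClass x ∧ IsOfHodgeType 6 X (2 * 3) 3 3 x},
          complexBetti.map a (2 * 3) c = complexBetti.map b (2 * 3) c') →
        IsRationalClass c →
        IsOfHodgeType (2 * 3) (AbelianVariety.kerComponent (𝟙 𝒥.J - s + s ≫ s)).X (2 * 3) 3 3 c →
        c ∈ weilClassesOf (AbelianVariety.kerComponent (𝟙 𝒥.J - s + s ≫ s)) ψ₀ 3 3 →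
        c ∈ algebraicClasses (AbelianVariety.kerComponent (𝟙 𝒥.J - s + s ≫ s)).X 3 := by
  intro C 𝒥 α _ _ s _ _ sB ψ₀ _ _ _ hB _ _ X T hXF hX hT a b ha c hc _ _ _
  obtain ⟨c', hc', hab⟩ := hc
  exact mem_algebraicClasses_of_fermatTransfer hF hP (m := 6) (Or.inr ⟨by norm_num, by norm_num⟩) hXF hX
    hB hT a b hc' hab

/-- **The same body from the rung R1′ itself** (`NonsplitSixfolds` at `d = 3`, `(A, φ) := (B, ψ₀)`; family
and datum not used): the non-split members of the family are a CASE of the rung. -/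
theorem nonsplitSixfolds_cyclicSexticPrym_fermat_of_nonsplitSixfolds (h : NonsplitSixfolds) :
    ∀ (C : Motives.SchemeOver ℂ) (𝒥 : Jacobian C) (α : C ⟶ C),
      IsSmoothProjective 1 C → α ≫ α ≫ α ≫ α ≫ α ≫ α = 𝟙 C →
    ∀ (s : 𝒥.J ⟶ 𝒥.J), s = 𝒥.pushforward 𝒥 α →
      𝟙 𝒥.J + s + s ≫ s + s ≫ s ≫ s + s ≫ s ≫ s ≫ s + s ≫ s ≫ s ≫ s ≫ s = 0 →
    ∀ (sB ψ₀ : AbelianVariety.kerComponent (𝟙 𝒥.J - s + s ≫ s) ⟶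
        AbelianVariety.kerComponent (𝟙 𝒥.J - s + s ≫ s)),
      sB ≫ AbelianVariety.kerComponentι (𝟙 𝒥.J - s + s ≫ s) =
        AbelianVariety.kerComponentι (𝟙 𝒥.J - s + s ≫ s) ≫ s →
      ψ₀ = 𝟙 _ + 2 • (sB ≫ sB) →
      (AbelianVariety.kerComponent (𝟙 𝒥.J - s + s ≫ s)).dim = 2 * 3 →
      IsSmoothProjective (2 * 3) (AbelianVariety.kerComponent (𝟙 𝒥.J - s + s ≫ s)).X →
      ψ₀ ≫ ψ₀ = -((3 : ℕ) • 𝟙 _) →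
      (∀ (e : Motives.ProjectiveEmbedding (AbelianVariety.kerComponent (𝟙 𝒥.J - s + s ≫ s)).X)
        (a : complexBetti (Motives.projectiveSpace e.n ℂ) 2), IsRationalClass a → a ≠ 0 →
          ¬ Motives.IsHyperbolicWeilType (AbelianVariety.kerComponent (𝟙 𝒥.J - s + s ≫ s)) ψ₀ 3
            (((3 : ℕ) : ℂ) • complexBetti.map e.ι 2 a +
              complexBetti.map ψ₀.hom.hom.hom 2 (complexBetti.map e.ι 2 a))) →
    ∀ (X T : Motives.SchemeOver ℂ),
      IsFermatVariety 6 6 X → IsSmoothProjective 6 X → IsSmoothProjective (2 * 3) T →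
    ∀ (a : T ⟶ (AbelianVariety.kerComponent (𝟙 𝒥.J - s + s ≫ s)).X) (b : T ⟶ X),
      AlgebraicGeometry.Surjective a.left →
      ∀ c : complexBetti (AbelianVariety.kerComponent (𝟙 𝒥.J - s + s ≫ s)).X (2 * 3),
        (∃ c' ∈ Submodule.span ℂ
            {x : complexBetti X (2 * 3) | IsRationalClass x ∧ IsOfHodgeType 6 X (2 * 3) 3 3 x},
          complexBetti.map a (2 * 3) c = complexBetti.map b (2 * 3) c') →
        IsRationalClass c →
        IsOfHodgeType (2 * 3) (AbelianVariety.kerComponent (𝟙 𝒥.J - s + s ≫ s)).X (2 * 3) 3 3 c →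
        c ∈ weilClassesOf (AbelianVariety.kerComponent (𝟙 𝒥.J - s + s ≫ s)) ψ₀ 3 3 →
        c ∈ algebraicClasses (AbelianVariety.kerComponent (𝟙 𝒥.J - s + s ≫ s)).X 3 := by
  intro C 𝒥 α _ _ s _ _ sB ψ₀ _ _ hdim hB hψ hnh _ _ _ _ _ _ _ _ c _ hc h33 hW
  exact h 3 (by norm_num) _ ψ₀ hdim hB hψ hnh c hc h33 hW

/-- **On-path lemma (CL4-candidate)**: the Hodge conjecture implies R1′ on the non-split ζ₆-primitive Prym
families over `ℙ¹` with 8 branch points and a Fermat transfer datum (`HodgeConjecture → NonsplitSixfolds →`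
the family). -/
theorem nonsplitSixfolds_cyclicSexticPrym_fermat_of_hodgeConjecture (h : _root_.HodgeConjecture) :
    ∀ (C : Motives.SchemeOver ℂ) (𝒥 : Jacobian C) (α : C ⟶ C),
      IsSmoothProjective 1 C → α ≫ α ≫ α ≫ α ≫ α ≫ α = 𝟙 C →
    ∀ (s : 𝒥.J ⟶ 𝒥.J), s = 𝒥.pushforward 𝒥 α →
      𝟙 𝒥.J + s + s ≫ s + s ≫ s ≫ s + s ≫ s ≫ s ≫ s + s ≫ s ≫ s ≫ s ≫ s = 0 →
    ∀ (sB ψ₀ : AbelianVariety.kerComponent (𝟙 𝒥.J - s + s ≫ s) ⟶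
        AbelianVariety.kerComponent (𝟙 𝒥.J - s + s ≫ s)),
      sB ≫ AbelianVariety.kerComponentι (𝟙 𝒥.J - s + s ≫ s) =
        AbelianVariety.kerComponentι (𝟙 𝒥.J - s + s ≫ s) ≫ s →
      ψ₀ = 𝟙 _ + 2 • (sB ≫ sB) →
      (AbelianVariety.kerComponent (𝟙 𝒥.J - s + s ≫ s)).dim = 2 * 3 →
      IsSmoothProjective (2 * 3) (AbelianVariety.kerComponent (𝟙 𝒥.J - s + s ≫ s)).X →
      ψ₀ ≫ ψ₀ = -((3 : ℕ) • 𝟙 _) →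
      (∀ (e : Motives.ProjectiveEmbedding (AbelianVariety.kerComponent (𝟙 𝒥.J - s + s ≫ s)).X)
        (a : complexBetti (Motives.projectiveSpace e.n ℂ) 2), IsRationalClass a → a ≠ 0 →
          ¬ Motives.IsHyperbolicWeilType (AbelianVariety.kerComponent (𝟙 𝒥.J - s + s ≫ s)) ψ₀ 3
            (((3 : ℕ) : ℂ) • complexBetti.map e.ι 2 a +
              complexBetti.map ψ₀.hom.hom.hom 2 (complexBetti.map e.ι 2 a))) →
    ∀ (X T : Motives.SchemeOver ℂ),
      IsFermatVariety 6 6 X → IsSmoothProjective 6 X → IsSmoothProjective (2 * 3) T →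
    ∀ (a : T ⟶ (AbelianVariety.kerComponent (𝟙 𝒥.J - s + s ≫ s)).X) (b : T ⟶ X),
      AlgebraicGeometry.Surjective a.left →
      ∀ c : complexBetti (AbelianVariety.kerComponent (𝟙 𝒥.J - s + s ≫ s)).X (2 * 3),
        (∃ c' ∈ Submodule.span ℂ
            {x : complexBetti X (2 * 3) | IsRationalClass x ∧ IsOfHodgeType 6 X (2 * 3) 3 3 x},
          complexBetti.map a (2 * 3) c = complexBetti.map b (2 * 3) c') →
        IsRationalClass c →
        IsOfHodgeType (2 * 3) (AbelianVariety.kerComponent (𝟙 𝒥.J - s + s ≫ s)).X (2 * 3) 3 3 c →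
        c ∈ weilClassesOf (AbelianVariety.kerComponent (𝟙 𝒥.J - s + s ≫ s)) ψ₀ 3 3 →
        c ∈ algebraicClasses (AbelianVariety.kerComponent (𝟙 𝒥.J - s + s ≫ s)).X 3 :=
  nonsplitSixfolds_cyclicSexticPrym_fermat_of_nonsplitSixfolds (nonsplitSixfolds_of_hodgeConjecture h)

end FamilyRonePrime

/-! ### §4 R3-shaped body (`WeilClassesCMField`, any CM field) on abelian varieties with a Fermat transfer datum -/

section Rthree

/-- **R3 on the Fermat-dominated locus, from the two facts.** The body of `WeilClassesCMField` (rung binders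
first and verbatim: `P(φ) = 0`, `P` monic irreducible of degree `e > 2`, CM, `e · 2m' = 2 dim A`), then a
Fermat transfer datum `(μ, k, X = Xᵏ_μ, T, a, b)` with `μ` prime or `1 < μ ≤ 20`, `dim T = dim A`,
`a : T ⟶ A` surjective, then for every class of `weilClassesField A φ P (2m')` with a Fermat partner `c'`
(in the span of the rational `(m',m')`-classes of `X`): rational of type `(m',m')` ⇒ algebraic. THEOREM F for
composite `μ ≤ 20` (packet §3.5: `E = ℚ(ζ_μ)`, non-simple Weil tuples over `ℙ¹`) in transferred form.
[cite: Shioda1979PJA, §2 Thm. 1 and the list after it (p. 112)] [cite: Fulton1998, §19.2 Cor. 19.2 (b)]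
[cite: MoonenZarhin1998WeilClasses, §1] -/
theorem weilClassesCMField_fermatTransfer_of_facts
    (hF : hodgeClasses_algebraic_fermat) (hP : fulton1998_map_mem_algebraicClasses) :
    ∀ (A : Motives.AbelianVariety ℂ) (φ : A ⟶ A) (P : Polynomial ℤ) (e m : ℕ),
      P.Monic → P.natDegree = e → 2 < e → Irreducible (P.map (Int.castRingHom ℚ)) →
      Polynomial.eval₂ (Int.castRingHom (CategoryTheory.End A)) (φ : CategoryTheory.End A) P = 0 →
      e * (2 * m) = 2 * A.dim →
      (∀ ρ : ℂ, Polynomial.eval₂ (Int.castRingHom ℂ) ρ P = 0 → starRingEnd ℂ ρ ≠ ρ) →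
      (∃ Q : Polynomial ℚ, ∀ ρ : ℂ, Polynomial.eval₂ (Int.castRingHom ℂ) ρ P = 0 →
          Polynomial.eval₂ (algebraMap ℚ ℂ) ρ Q = starRingEnd ℂ ρ) →
    ∀ (μ k : ℕ), μ.Prime ∨ (1 < μ ∧ μ ≤ 20) → ∀ (X T : Motives.SchemeOver ℂ),
      IsFermatVariety k μ X → IsSmoothProjective k X → IsSmoothProjective A.dim T →
    ∀ (a : T ⟶ A.X) (b : T ⟶ X), AlgebraicGeometry.Surjective a.left →
      ∀ c ∈ weilClassesField A φ P (2 * m),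
        (∃ c' ∈ Submodule.span ℂ
            {x : complexBetti X (2 * m) | IsRationalClass x ∧ IsOfHodgeType k X (2 * m) m m x},
          complexBetti.map a (2 * m) c = complexBetti.map b (2 * m) c') →
        IsRationalClass c → IsOfHodgeType A.dim A.X (2 * m) m m c → c ∈ algebraicClasses A.X m := by
  intro A φ P e m _ _ _ _ _ _ _ _ μ k hμ X T hXF hX hT a b ha c _ hc _ _
  obtain ⟨c', hc', hab⟩ := hc
  exact abelianVariety_mem_algebraicClasses_of_fermatTransfer hF hP A hμ hXF hX hT a b hc' hab

/-- **The same body from the rung R3 itself** (`WeilClassesCMField`; the datum is not used). -/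
theorem weilClassesCMField_fermatTransfer_of_weilClassesCMField (h : WeilClassesCMField) :
    ∀ (A : Motives.AbelianVariety ℂ) (φ : A ⟶ A) (P : Polynomial ℤ) (e m : ℕ),
      P.Monic → P.natDegree = e → 2 < e → Irreducible (P.map (Int.castRingHom ℚ)) →
      Polynomial.eval₂ (Int.castRingHom (CategoryTheory.End A)) (φ : CategoryTheory.End A) P = 0 →
      e * (2 * m) = 2 * A.dim →
      (∀ ρ : ℂ, Polynomial.eval₂ (Int.castRingHom ℂ) ρ P = 0 → starRingEnd ℂ ρ ≠ ρ) →
      (∃ Q : Polynomial ℚ, ∀ ρ : ℂ, Polynomial.eval₂ (Int.castRingHom ℂ) ρ P = 0 →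
          Polynomial.eval₂ (algebraMap ℚ ℂ) ρ Q = starRingEnd ℂ ρ) →
    ∀ (μ k : ℕ), μ.Prime ∨ (1 < μ ∧ μ ≤ 20) → ∀ (X T : Motives.SchemeOver ℂ),
      IsFermatVariety k μ X → IsSmoothProjective k X → IsSmoothProjective A.dim T →
    ∀ (a : T ⟶ A.X) (b : T ⟶ X), AlgebraicGeometry.Surjective a.left →
      ∀ c ∈ weilClassesField A φ P (2 * m),
        (∃ c' ∈ Submodule.span ℂ
            {x : complexBetti X (2 * m) | IsRationalClass x ∧ IsOfHodgeType k X (2 * m) m m x},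
          complexBetti.map a (2 * m) c = complexBetti.map b (2 * m) c') →
        IsRationalClass c → IsOfHodgeType A.dim A.X (2 * m) m m c → c ∈ algebraicClasses A.X m := by
  intro A φ P e m hP1 hP2 hP3 hP4 hP5 hP6 hP7 hP8 _ _ _ _ _ _ _ _ _ _ _ c hcW _ hc hmm
  exact h A φ P e m hP1 hP2 hP3 hP4 hP5 hP6 hP7 hP8 c hcW hc hmm

/-- **On-path lemma**: the Hodge conjecture implies R3 on the Fermat-dominated locus
(`HodgeConjecture → WeilClassesCMField →` the locus). -/
theorem weilClassesCMField_fermatTransfer_of_hodgeConjecture (h : _root_.HodgeConjecture) :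
    ∀ (A : Motives.AbelianVariety ℂ) (φ : A ⟶ A) (P : Polynomial ℤ) (e m : ℕ),
      P.Monic → P.natDegree = e → 2 < e → Irreducible (P.map (Int.castRingHom ℚ)) →
      Polynomial.eval₂ (Int.castRingHom (CategoryTheory.End A)) (φ : CategoryTheory.End A) P = 0 →
      e * (2 * m) = 2 * A.dim →
      (∀ ρ : ℂ, Polynomial.eval₂ (Int.castRingHom ℂ) ρ P = 0 → starRingEnd ℂ ρ ≠ ρ) →
      (∃ Q : Polynomial ℚ, ∀ ρ : ℂ, Polynomial.eval₂ (Int.castRingHom ℂ) ρ P = 0 →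
          Polynomial.eval₂ (algebraMap ℚ ℂ) ρ Q = starRingEnd ℂ ρ) →
    ∀ (μ k : ℕ), μ.Prime ∨ (1 < μ ∧ μ ≤ 20) → ∀ (X T : Motives.SchemeOver ℂ),
      IsFermatVariety k μ X → IsSmoothProjective k X → IsSmoothProjective A.dim T →
    ∀ (a : T ⟶ A.X) (b : T ⟶ X), AlgebraicGeometry.Surjective a.left →
      ∀ c ∈ weilClassesField A φ P (2 * m),
        (∃ c' ∈ Submodule.span ℂ
            {x : complexBetti X (2 * m) | IsRationalClass x ∧ IsOfHodgeType k X (2 * m) m m x},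
          complexBetti.map a (2 * m) c = complexBetti.map b (2 * m) c') →
        IsRationalClass c → IsOfHodgeType A.dim A.X (2 * m) m m c → c ∈ algebraicClasses A.X m :=
  weilClassesCMField_fermatTransfer_of_weilClassesCMField (weilClassesCMField_of_hodgeConjecture h)

end Rthree

end Summit.HodgeConjecture.HodgeConjecture.WeilTypeLadder

end
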